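import Summits.BirchSwinnertonDyer.BirchSwinnertonDyer.Theorems.TwoAdicConverseOrdLambdaHalfAtTwoShapiroDatumDefs
import Summits.BirchSwinnertonDyer.BirchSwinnertonDyer.Theorems.TwoAdicConverseOrdLambdaHalfAtTwoPinnedMinusSide
import HarnessLib

/-!
# Route `TwoAdicConverse` (rung S3), crux `OrdLambdaHalfAtTwo` (item stmt-BirchSwinnertonDyer-19556), line
# `kato-determinant-greenberg-two`, skeleton v4.3: KERNEL theorems of the Shapiro-corrected pinned datum
# (the `λ`-bridge over the Shapiro defect, Poitou–Tate counted two ways, transparency, nothing of v4 lost)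

Seat `cruxlead-stmt-BirchSwinnertonDyer-19556-g2` (LEAD PROVER, MODE LINE; `--supports` stmt-BirchSwinnertonDyer-19556, helper; HOME
`run/shared/lean/pub/bsd-2adic/`).  HONEST FRAMING (cell bsd-2adic): BSD is not proved by any of this; the crux `OrdLambdaHalfAtTwo` is NOT proved
here; nothing about any particular curve is asserted; no definition, no named fact, no `sorry`.

Objects: `…ShapiroDatumDefs` (lead g2): the compact core `PinnedKatoCore`, the Shapiro-corrected datum `ShapiroKatoGreenbergDatum` (Poitou–Tate source
`𝐇¹_loc ⧸ L`, `range ≤ L`, `2·L ≤ range`), `gD`, the displayed binders `ShapiroKatoGreenbergSupplyAtTwo` / `ShapiroGreenbergDivisibilityAtTwo`.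
THIS FILE: §0 two generic `λ`-lemmas (a sub-quotient killed by powers of `p` is `λ`-invisible; conv-1's Poitou–Tate-two-ways with its step (A) as a
hypothesis); §1 the `±`-decomposition of `gD` on the core (p674487 §2 re-proved field for field) and torsion of `𝐇¹_loc ⧸ range`; §2 for the Shapiro datum:
the BRIDGE `λ(𝐇¹_loc ⧸ range) = λ(𝐇¹_loc ⧸ L)`, the `λ`-Poitou–Tate identity `lambda_PT` (= triage r1-1's repair R2, DERIVED), hPT `lambda_add_eq`
`λ(X_Gr) + (λL₀ + λL₀') = gD + (b + b')`, the transparency theorem `gD_le_lambda_iff` (stub 6″ ⟺ the summed `λ`-inequality; under Kato's two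
inequalities ⟺ the `λ`-main-conjecture pair) — all UNCHANGED in content from v4; §3 nothing of v4 is lost: the v4 ∃-supply implies the v4.3 one, the
v4.3 ∀-divisibility implies the v4 one (through `PinnedKatoGreenbergDatum.toShapiro`, `L := range`).

References: K. Kato, Astérisque 295 (2004) §17.13 [Kato2004Asterisque]; R. Greenberg, V. Vatsal, Invent. Math. 142 (2000) §2 [GreenbergVatsal2000];
L. Washington, GTM 83 §13.2 [Washington1997]; R. Greenberg, LNM 1716 §1 [GreenbergLNM1716]; triage r1-1 `TRIAGE-r1-1.md` Δ16-1/Δ17-1/Δ17-2.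
-/

set_option linter.dupNamespace false
set_option autoImplicit false

noncomputable section

open scoped Classical NumberField
open WeierstrassCurve NumberField IsDedekindDomain Field CategoryTheory Function
open Literature.NumberTheory.EllipticCurves Literature.NumberTheory.EllipticCurves.Rank1Residual
open Literature.NumberTheory.EllipticCurves.Kato2004 Literature.NumberTheory.EllipticCurves.Kato2004.EulerSystemValues
open Literature.NumberTheory.GaloisRepresentations
open Summit.BirchSwinnertonDyer.Rank1Residual.X1.MuLambda (lam)
open Summit.BirchSwinnertonDyer.Rank1Residual.X11b (AcSelmer.bdpData AcSelmer.strictDatum)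

namespace Summit.BirchSwinnertonDyer.BirchSwinnertonDyer.Theorems.TwoAdicKatoDeterminant

/-! ## §0 Two generic `λ`-lemmas (pure `Λ`-module algebra) -/

section Algebra

variable (p : ℕ) [Fact p.Prime]

open Summit.BirchSwinnertonDyer.BirchSwinnertonDyer.Theorems.TwoAdicPoitouTateTwoWays

/-- **`λ` does not see a sub-quotient killed by powers of `p`**: for submodules `S ≤ T` of `M` with `M ⧸ S` finitely generated torsion
and every element of `T` pushed into `S` by some power of `p`, `λ(M ⧸ S) = λ(M ⧸ T)` (`λ(M⧸S) = λ(T⧸S) + λ(M⧸T)` and `λ(T⧸S) = 0`).  The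
bridge between the literal localisation lattice `range(loc_W ⊕ loc_A)` and the Shapiro lattice `L` of §2 (`2·L ≤ range`).
[cite: Washington1997, §13.2] -/
theorem lambdaInvariant_quotient_eq_of_forall_exists_C_pow_smul_mem {M : Type*} [AddCommGroup M]
    [Module (IwasawaAlgebra p) M] (S T : Submodule (IwasawaAlgebra p) M) (hST : S ≤ T)
    (hTS : ∀ y ∈ T, ∃ k : ℕ, (PowerSeries.C ((p : ℤ_[p]) ^ k) : IwasawaAlgebra p) • y ∈ S)
    [Module.Finite (IwasawaAlgebra p) (M ⧸ S)] (h : Module.IsTorsion (IwasawaAlgebra p) (M ⧸ S)) :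
    lambdaInvariant p (M ⧸ S) = lambdaInvariant p (M ⧸ T) := by
  rw [lambdaInvariant_quotient_eq_add p S T hST h]
  have h0 : lambdaInvariant p ↥(T.map S.mkQ) = 0 := by
    refine lambdaInvariant_eq_zero_of_forall_exists_C_pow_smul_eq_zero fun x ↦ ?_
    obtain ⟨y, hy, hyx⟩ := Submodule.mem_map.1 x.2
    obtain ⟨k, hk⟩ := hTS y hy
    refine ⟨k, Subtype.ext ?_⟩
    rw [Submodule.coe_smul, ← hyx, Submodule.mkQ_apply, ← Submodule.Quotient.mk_smul, Submodule.coe_zero,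
      (Submodule.Quotient.mk_eq_zero S).2 hk]
  rw [h0, zero_add]

variable {HW : Type*} {HA : Type*} {Hl : Type*} {X Xf : Type*}
  [AddCommGroup HW] [Module (IwasawaAlgebra p) HW]
  [AddCommGroup HA] [Module (IwasawaAlgebra p) HA]
  [AddCommGroup Hl] [Module (IwasawaAlgebra p) Hl]
  [AddCommGroup X] [Module (IwasawaAlgebra p) X]
  [AddCommGroup Xf] [Module (IwasawaAlgebra p) Xf]

/-- **Poitou–Tate counted two ways from the `λ`-identity** — conv-1's `TwoAdicPoitouTateTwoWays.lambda_poitouTate_twoWays` (p656013) with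
its step (A) «`λ(X) = λ(Hl ⧸ range(loc_W ⊕ loc_A)) + λ(X_f)`» taken as a HYPOTHESIS instead of read off a literal short exact sequence (so that
it serves the Shapiro-corrected datum of §2, whose Poitou–Tate source is `Hl ⧸ L`, through the bridge above).  Steps (B) `λ(Hl⧸Z') = λ(R⧸Z') + λ(Hl⧸R)`
and (C) `λ(R⧸Z') = λ(HW⧸ZW) + λ(HA⧸ZA)` verbatim. [cite: Washington1997, §13.2] [cite: GreenbergLNM1716, §1] -/
theorem lambda_twoWays_of_lambdaPT [Module.Finite (IwasawaAlgebra p) Hl]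
    (locW : HW →ₗ[IwasawaAlgebra p] Hl) (locA : HA →ₗ[IwasawaAlgebra p] Hl)
    (ZW : Submodule (IwasawaAlgebra p) HW) (ZA : Submodule (IwasawaAlgebra p) HA)
    (hloc : Injective (locW.coprod locA))
    (htor : Module.IsTorsion (IwasawaAlgebra p) (Hl ⧸ (ZW.map locW ⊔ ZA.map locA)))
    {a a' b b' : ℕ}
    (hA : lambdaInvariant p X =
      lambdaInvariant p (Hl ⧸ LinearMap.range (locW.coprod locA)) + lambdaInvariant p Xf)
    (hKato : lambdaInvariant p (HW ⧸ ZW) + lambdaInvariant p (HA ⧸ ZA) + (b + b') =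
      lambdaInvariant p Xf + (a + a')) :
    lambdaInvariant p X + (a + a') =
      lambdaInvariant p (Hl ⧸ (ZW.map locW ⊔ ZA.map locA)) + (b + b') := by
  haveI : IsNoetherianRing (IwasawaAlgebra p) := inferInstance
  have hZ'R : ZW.map locW ⊔ ZA.map locA ≤ LinearMap.range (locW.coprod locA) :=
    map_sup_map_le_range_coprod p locW locA ZW ZA
  -- (B) `λ(Hl⧸Z') = λ(R.map Z'.mkQ) + λ(Hl⧸R)`
  have hB : lambdaInvariant p (Hl ⧸ (ZW.map locW ⊔ ZA.map locA)) =
      lambdaInvariant p ↥((LinearMap.range (locW.coprod locA)).map (ZW.map locW ⊔ ZA.map locA).mkQ) +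
        lambdaInvariant p (Hl ⧸ LinearMap.range (locW.coprod locA)) :=
    lambdaInvariant_quotient_eq_add p _ _ hZ'R htor
  -- (C) `λ(R.map Z'.mkQ) = λ(HW⧸ZW) + λ(HA⧸ZA)`
  obtain ⟨e⟩ := nonempty_rangeMapMkQ_equiv_prod p locW locA ZW ZA hloc
  haveI : IsNoetherian (IwasawaAlgebra p) (Hl ⧸ (ZW.map locW ⊔ ZA.map locA)) :=
    isNoetherian_of_isNoetherianRing_of_finite _ _
  haveI : Module.Finite (IwasawaAlgebra p)
      ↥((LinearMap.range (locW.coprod locA)).map (ZW.map locW ⊔ ZA.map locA).mkQ) :=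
    Module.Finite.of_injective (Submodule.subtype _) (Submodule.subtype_injective _)
  haveI : Module.Finite (IwasawaAlgebra p) ((HW ⧸ ZW) × (HA ⧸ ZA)) := Module.Finite.equiv e
  have htorSub : Module.IsTorsion (IwasawaAlgebra p)
      ↥((LinearMap.range (locW.coprod locA)).map (ZW.map locW ⊔ ZA.map locA).mkQ) :=
    isTorsion_of_injective p (Submodule.subtype _) (Submodule.subtype_injective _) htor
  have htorProd : Module.IsTorsion (IwasawaAlgebra p) ((HW ⧸ ZW) × (HA ⧸ ZA)) :=
    isTorsion_of_surjective p e.toLinearMap e.surjective htorSub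
  have hC : lambdaInvariant p
      ↥((LinearMap.range (locW.coprod locA)).map (ZW.map locW ⊔ ZA.map locA).mkQ) =
        lambdaInvariant p (HW ⧸ ZW) + lambdaInvariant p (HA ⧸ ZA) := by
    rw [lambdaInvariant_eq_of_linearEquiv e, lambdaInvariant_prod p htorProd]
  omega

end Algebra

/-! ## §1–§2 Kernel theorems of the core and of the Shapiro datum -/

section Kernel

variable {W : WeierstrassCurve ℚ} [W.IsElliptic] [ContinuousSMul ℤ_[2] (W.tateModule 2)]
  {A : WeierstrassCurve ℚ} [A.IsElliptic] [ContinuousSMul ℤ_[2] (A.tateModule 2)]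
  {κ : ZpExtension ℚ 2} {γ : absoluteGaloisGroup ℚ}
  {I_W : IwasawaH1Data W 2 κ γ} {I_A : IwasawaH1Data A 2 κ γ}
  {v : HeightOneSpectrum (𝓞 ℚ)} {γᵥ : absoluteGaloisGroup (v.adicCompletion ℚ)}
  {J : LocalIwasawaH1Data κ v ((tateRep W 2).toLocal v) γᵥ}
  {J' : LocalIwasawaH1Data κ v (tateLocalOrdinaryRep W 2 v) γᵥ}
  {J_A : LocalIwasawaH1Data κ v ((tateRep A 2).toLocal v) γᵥ}
  {uA : ((tateRep A 2).toLocal v).toTopRep ⟶ ((tateRep W 2).toLocal v).toTopRep}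
  {hsurj : Function.Surjective
    (κ.toContinuousMonoidHom.comp (resGalOfEmb (closureEmb (K := ℚ) (v.adicCompletion ℚ))))}
  {hγ : κ.IsTopGenerator γ}
  {hγᵥ : κ.IsTopGenerator (resGalOfEmb (closureEmb (K := ℚ) (v.adicCompletion ℚ)) γᵥ)}
  {K : Type} [Field K] [NumberField K] {κK : ZpExtension K 2} {γK : absoluteGaloisGroup K}
  {w : HeightOneSpectrum (𝓞 K)}
  {DGr : (W.baseChange K).GreenbergStrictSelmerDualData κK γK (AcSelmer.bdpData (MK W K) 2 w)}
  {Dfi : (W.baseChange K).GreenbergStrictSelmerDualData κK γK (fineData W K)}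
  {L₀ L₀' : IwasawaAlgebra 2} {b b' : ℕ}

namespace PinnedKatoCore

variable (C : PinnedKatoCore I_W I_A J J' J_A uA hsurj hγ hγᵥ L₀ L₀')

/-- The localised zeta span lies in the localisation lattice `range(loc_W ⊕ 𝐇¹(u_A)∘loc_A)`. [folklore] -/
theorem zetaSpan_le_range :
    C.zetaSpan ≤ LinearMap.range ((I_W.loc J hsurj hγ hγᵥ).coprod (J_A.map uA J ∘ₗ I_A.loc J_A hsurj hγ hγᵥ)) :=
  Summit.BirchSwinnertonDyer.BirchSwinnertonDyer.Theorems.TwoAdicPoitouTateTwoWays.map_sup_map_le_range_coprod 2 _ _ _ _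

/-- **`gD = λ(H_f ⧸ (H_f ⊓ S)) + λ(𝐇¹_loc ⧸ (H_f ⊔ S))`** for every core (`S` = the localised zeta span, `H_f` = the `F⁺`-part): the
`±`-decomposition of the Kato determinant (p674487 §2, re-proved on the core; second isomorphism theorem and `λ`-additivity).  READING: the
`F⁻`-summand is read by the first reciprocity law (`Col⁻`), the `F⁺`-summand is the BDP/Greenberg side.  Nothing about either summand is asserted.
[cite: Kato2004Asterisque, §17.13 (17.13.1)–(17.13.3) (shape only)] [cite: Washington1997, §13.2] -/
theorem gD_eq_lambda_plus_add_lambda_minus :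
    C.gD = lambdaInvariant 2 (↥(localOrdinaryPart J' J) ⧸ (C.zetaSpan).comap (localOrdinaryPart J' J).subtype) +
      lambdaInvariant 2 (J.H ⧸ (localOrdinaryPart J' J ⊔ C.zetaSpan)) := by
  haveI := C.finiteHl
  have htor : Module.IsTorsion (IwasawaAlgebra 2) (J.H ⧸ C.zetaSpan) := C.isTorsion_quot
  rw [gD_eq, Summit.BirchSwinnertonDyer.BirchSwinnertonDyer.Theorems.TwoAdicPoitouTateTwoWays.lambdaInvariant_quotient_eq_add 2
    C.zetaSpan (localOrdinaryPart J' J ⊔ C.zetaSpan) le_sup_right htor]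
  congr 1
  have hmap : (localOrdinaryPart J' J ⊔ C.zetaSpan).map C.zetaSpan.mkQ =
      LinearMap.range (C.zetaSpan.mkQ ∘ₗ (localOrdinaryPart J' J).subtype) := by
    rw [Submodule.map_sup, Submodule.mkQ_map_self, sup_bot_eq, LinearMap.range_comp, Submodule.range_subtype]
  have hker : LinearMap.ker (C.zetaSpan.mkQ ∘ₗ (localOrdinaryPart J' J).subtype) =
      (C.zetaSpan).comap (localOrdinaryPart J' J).subtype := by
    rw [LinearMap.ker_comp, Submodule.ker_mkQ]
  exact (lambdaInvariant_eq_of_linearEquiv ((Submodule.quotEquivOfEq _ _ hker).symm.trans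
    ((LinearMap.quotKerEquivRange _).trans (LinearEquiv.ofEq _ _ hmap.symm)))).symm

include C in
/-- `𝐇¹_loc ⧸ range(loc_W ⊕ 𝐇¹(u_A)∘loc_A)` is `Λ`-torsion (a quotient of `𝐇¹_loc ⧸ S`). [folklore] -/
theorem isTorsion_quotient_range : Module.IsTorsion (IwasawaAlgebra 2)
    (J.H ⧸ LinearMap.range ((I_W.loc J hsurj hγ hγᵥ).coprod (J_A.map uA J ∘ₗ I_A.loc J_A hsurj hγ hγᵥ))) :=
  Summit.BirchSwinnertonDyer.BirchSwinnertonDyer.Theorems.TwoAdicPoitouTateTwoWays.isTorsion_of_surjective 2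
    (Submodule.factor C.zetaSpan_le_range) (Submodule.factor_surjective C.zetaSpan_le_range) C.isTorsion_quot

end PinnedKatoCore

namespace ShapiroKatoGreenbergDatum

variable (S : ShapiroKatoGreenbergDatum I_W I_A J J' J_A uA hsurj hγ hγᵥ DGr Dfi L₀ L₀' b b')

/-- **The bridge**: `λ(𝐇¹_loc ⧸ range) = λ(𝐇¹_loc ⧸ L)` — the Shapiro defect `L ⧸ range` is killed by `2`, hence `λ`-invisible.
[cite: Washington1997, §13.2] -/
theorem lambdaInvariant_quotient_range_eq_quotient_L :
    lambdaInvariant 2 (J.H ⧸ LinearMap.range ((I_W.loc J hsurj hγ hγᵥ).coprod (J_A.map uA J ∘ₗ I_A.loc J_A hsurj hγ hγᵥ))) =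
      lambdaInvariant 2 (J.H ⧸ S.L) := by
  haveI := S.finiteHl
  refine lambdaInvariant_quotient_eq_of_forall_exists_C_pow_smul_mem 2 _ _ S.range_le (fun y hy ↦ ⟨1, ?_⟩)
    S.toPinnedKatoCore.isTorsion_quotient_range
  rw [pow_one, map_natCast, Nat.cast_ofNat]
  exact S.two_smul_mem y hy

include S in
/-- **R2 as a THEOREM (`λ`-Poitou–Tate)**: for a Shapiro datum with `X_Gr` finitely generated torsion,
`λ(X_Gr) = λ(𝐇¹_loc ⧸ range(loc_W ⊕ 𝐇¹(u_A)∘loc_A)) + λ(X_fine)` (exactness of `0 → 𝐇¹_loc ⧸ L → X_Gr → X_fine → 0` and the bridge).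
[cite: GreenbergVatsal2000, §2] [cite: Washington1997, §13.2] -/
theorem lambda_PT (h : Module.Finite (IwasawaAlgebra 2) DGr.X ∧ Module.IsTorsion (IwasawaAlgebra 2) DGr.X) :
    lambdaInvariant 2 DGr.X =
      lambdaInvariant 2 (J.H ⧸ LinearMap.range ((I_W.loc J hsurj hγ hγᵥ).coprod (J_A.map uA J ∘ₗ I_A.loc J_A hsurj hγ hγᵥ))) +
        lambdaInvariant 2 Dfi.X := by
  haveI := h.1
  rw [S.lambdaInvariant_quotient_range_eq_quotient_L]
  exact Summit.BirchSwinnertonDyer.BirchSwinnertonDyer.Theorems.TwoAdicPoitouTateTwoWays.lambdaInvariant_eq_add_of_exact 2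
    h.2 S.δ S.π S.δ_injective S.π_surjective S.exact_δ_π

/-- **hPT — Poitou–Tate counted two ways** for the Shapiro datum: with `X_Gr` finitely generated torsion,
`λ(X_Gr) + (λ L₀ + λ L₀') = gD + (b + b')`. [cite: Kato2004Asterisque, §17.13] [cite: GreenbergVatsal2000, §2] -/
theorem lambda_add_eq (h : Module.Finite (IwasawaAlgebra 2) DGr.X ∧ Module.IsTorsion (IwasawaAlgebra 2) DGr.X) :
    lambdaInvariant 2 DGr.X + (lam L₀ + lam L₀') = S.gD + (b + b') := by
  haveI := S.finiteHl
  exact lambda_twoWays_of_lambdaPT 2 (I_W.loc J hsurj hγ hγᵥ) (J_A.map uA J ∘ₗ I_A.loc J_A hsurj hγ hγᵥ)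
    (Submodule.span (IwasawaAlgebra 2) {S.zW}) (Submodule.span (IwasawaAlgebra 2) {S.zA}) S.loc_injective
    S.isTorsion_quot (S.lambda_PT h) S.katoIndex

/-- `gD + (b + b') = λ(X_Gr) + (λ L₀ + λ L₀')`: the Kato determinant's `λ` is forced by the shadows. [cite: Kato2004Asterisque, §17.13] -/
theorem gD_add_eq (h : Module.Finite (IwasawaAlgebra 2) DGr.X ∧ Module.IsTorsion (IwasawaAlgebra 2) DGr.X) :
    S.gD + (b + b') = lambdaInvariant 2 DGr.X + (lam L₀ + lam L₀') :=
  (S.lambda_add_eq h).symm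

/-- **Transparency (unchanged by the re-typing)**: for a Shapiro datum with `X_Gr` finitely generated torsion,
`gD ≤ λ(X_Gr) ↔ λ L₀ + λ L₀' ≤ b + b'` — stub 6″ is, datum by datum, the summed `λ`-inequality. [cite: GreenbergVatsal2000, §2] -/
theorem gD_le_lambda_iff (h : Module.Finite (IwasawaAlgebra 2) DGr.X ∧ Module.IsTorsion (IwasawaAlgebra 2) DGr.X) :
    S.gD ≤ lambdaInvariant 2 DGr.X ↔ lam L₀ + lam L₀' ≤ b + b' := by
  have := S.lambda_add_eq h
  omega

/-- Under Kato's two inequalities `b ≤ λ L₀`, `b' ≤ λ L₀'`, stub 6″ IS the `λ`-main-conjecture pair `λ L₀ = b ∧ λ L₀' = b'`.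
[cite: Kato2004Asterisque, Thm 17.4] -/
theorem gD_le_lambda_iff_eq_and_eq (h : Module.Finite (IwasawaAlgebra 2) DGr.X ∧ Module.IsTorsion (IwasawaAlgebra 2) DGr.X)
    (hb : b ≤ lam L₀) (hb' : b' ≤ lam L₀') :
    S.gD ≤ lambdaInvariant 2 DGr.X ↔ lam L₀ = b ∧ lam L₀' = b' := by
  rw [S.gD_le_lambda_iff h]
  omega

/-- How the skeleton's `omega` spine consumes 6″: `gD ≤ λ(X_Gr)` and `b' ≤ λ L₀'` give `λ L₀ ≤ b`. [cite: Kato2004Asterisque, Thm 17.4] -/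
theorem lam_le_of_gD_le_lambda (h : Module.Finite (IwasawaAlgebra 2) DGr.X ∧ Module.IsTorsion (IwasawaAlgebra 2) DGr.X)
    (hGr : S.gD ≤ lambdaInvariant 2 DGr.X) (hb' : b' ≤ lam L₀') : lam L₀ ≤ b := by
  have := (S.gD_le_lambda_iff h).mp hGr
  omega

/-- The `±`-decomposition for a Shapiro datum (through its core). [cite: Kato2004Asterisque, §17.13 (shape only)] -/
theorem gD_eq_lambda_plus_add_lambda_minus :
    S.gD = lambdaInvariant 2 (↥(localOrdinaryPart J' J) ⧸ (S.toPinnedKatoCore.zetaSpan).comap (localOrdinaryPart J' J).subtype) +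
      lambdaInvariant 2 (J.H ⧸ (localOrdinaryPart J' J ⊔ S.toPinnedKatoCore.zetaSpan)) :=
  S.toPinnedKatoCore.gD_eq_lambda_plus_add_lambda_minus

end ShapiroKatoGreenbergDatum

end Kernel

/-! ## §5 Nothing of v4 is lost: the v4 binders versus the v4.3 binders -/

/-- The v4 ∃-supply (mis-typed: stronger, false on `{Δ_W < 0}` modulo print) IMPLIES the v4.3 ∃-supply (`toShapiro`, `L := range`).
[cite: Kato2004Asterisque, §17.13 (shape only)] -/
theorem shapiroSupply_of_pinnedSupply (h : PinnedKatoGreenbergSupplyAtTwo) : ShapiroKatoGreenbergSupplyAtTwo := by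
  intro W _ _ hCM hGO hβ κ γ hκ hγ hγ' hord _ f hf D L₀ hL₀ K _ _ hK A _ _ C hA hordA _ g hg DA L₀' hL₀' w hw κK γK hκK hγK
    DGr Dfi hcot _ _
  obtain ⟨v, γᵥ, hsurj, hγᵥ, I_W, I_A, J, J', J_A, uA, ⟨P⟩⟩ := h W hCM hGO hβ κ γ hκ hγ hγ' hord f hf D L₀ hL₀ K hK A C hA
    hordA g hg DA L₀' hL₀' w hw κK γK hκK hγK DGr Dfi hcot
  exact ⟨v, γᵥ, hsurj, hγᵥ, I_W, I_A, J, J', J_A, uA, ⟨P.toShapiro⟩⟩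

/-- The v4.3 ∀-divisibility IMPLIES the v4 ∀-divisibility (every v4 datum is a v4.3 datum with the same `gD`).
[cite: Kato2004Asterisque, §17.13 (shape only)] -/
theorem pinnedDivisibility_of_shapiroDivisibility (h : ShapiroGreenbergDivisibilityAtTwo) :
    PinnedGreenbergDivisibilityAtTwo := by
  intro W _ _ hCM hGO hβ κ γ hκ hγ hγ' hord _ f hf D L₀ hL₀ K _ _ hK A _ _ C hA hordA _ g hg DA L₀' hL₀' w hw κK γK hκK hγK
    DGr Dfi hcot _ _ v γᵥ hsurj hγᵥ I_W I_A J J' J_A uA P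
  rw [← P.toShapiro_gD]
  exact h W hCM hGO hβ κ γ hκ hγ hγ' hord f hf D L₀ hL₀ K hK A C hA hordA g hg DA L₀' hL₀' w hw κK γK hκK hγK DGr Dfi hcot
    v γᵥ hsurj hγᵥ I_W I_A J J' J_A uA P.toShapiro

end Summit.BirchSwinnertonDyer.BirchSwinnertonDyer.Theorems.TwoAdicKatoDeterminant

end
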